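import Mathlib
import Summits.Ventures.HodgeRepro.OcticCMPointGaloisRing

/-!
# OcticCMPointGaloisRingTrace — the trace `GR(4, 4) → ℤ/4`, a trace-zero unit `δ`, and the additive character `ψ̃_δ`

Blind re-derivation cell `pub-hodge-repro`, seat night-2 (gen 4, final cycle).  Target tree path
`lean/Summits/Ventures/HodgeRepro/OcticCMPointGaloisRingTrace.lean`.  Second step of the conductor-`2` line at the
inert place `𝔮 | 2` (`OcticCMPointGaloisRing.lean` = the ring `GR(4, 4) = ℤ/4[r]/(r⁴ + 2r² + 3r + 1)` with the
Frobenius lift `φ : r ↦ r²` and the conjugation `σ = φ²`):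

* `tr` — **the trace `GR(4, 4) → ℤ/4`**, defined as `3 ·` (the top coordinate in the power basis `1, r, r², r³`)
  and CHARACTERISED Galois-theoretically: `algebraMap (tr y) = y + φ(y) + φ²(y) + φ³(y)` (`frobSum_eq_tr`, checked
  on the basis: `Tr(1) = Tr(r) = Tr(r²) = 0`, `Tr(r³) = 3`); hence `tr ∘ σ = tr` (`tr_conjGR`);
* `delta = 1 + 2r² = r − σ(r)` — **a trace-zero unit**: `σ(δ) = −δ` (`conjGR_delta`), `δ² = 1` (`delta_mul_self`);
* `psiTildeGR = ψ₄ ∘ tr ∘ (δ ·)` with `ψ₄ = i^x` the standard character of `ℤ/4` — the additive character of the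
  route's shape `ψ_δ(x) = ψ(Tr(δ x))`, with **`ψ̃_δ ∘ σ = ψ̃_δ ∘ (−1 ·)`** (`psiTildeGR_conjGR`): the hypothesis `hψ`
  of gen 3's `conjDual_inert` at conductor `2` (at conductor `1`, `−x = x` and `δ = 1` sufficed).

**What this is not.**  The primitivity of `ψ̃_δ` (the Gram matrix of `(a, b) ↦ tr(δ a b)` in the power basis has
determinant `1` mod `4` — `numerics/gr44_trace.py`; the Lean proof is the next module), the unit group of `GR(4, 4)`
and the conductor-`2` Gauss sums are NOT here.  Nothing here says anything about the status of the Hodge conjecture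
for CM abelian varieties, which is NOT proved.
-/

set_option autoImplicit false

noncomputable section

open Polynomial

namespace Summit.Ventures.HodgeRepro.PeriodCloser

namespace GaloisRing

/-! ### The power basis in closed form -/

/-- `pb.gen = r`. -/
theorem pb_gen : pb.gen = r := rfl

/-- `pb.basis i = r ^ i`. -/
theorem pb_basis_apply (i : Fin pb.dim) : pb.basis i = r ^ (i : ℕ) := by
  rw [pb.basis_eq_pow, pb_gen]

/-- The index `3` of the power basis (`pb.dim = 4`). -/
def idx3 : Fin pb.dim := ⟨3, by rw [pb_dim]; norm_num⟩

/-- The index `0` of the power basis. -/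
def idx0 : Fin pb.dim := ⟨0, by rw [pb_dim]; norm_num⟩

/-- **The trace `GR(4, 4) → ℤ/4`**, as `3 ·` the top coordinate in the power basis `1, r, r², r³`
(`ℤ/4`-linear). -/
def trL : GR44 →ₗ[ZMod 4] ZMod 4 := (3 : ZMod 4) • pb.basis.coord idx3

/-- The trace as a function. -/
def tr (y : GR44) : ZMod 4 := trL y

/-- `tr y = 3 · (the `r³`-coordinate of `y`)`. -/
theorem tr_apply (y : GR44) : tr y = 3 * pb.basis.repr y idx3 := by
  unfold tr trL
  rw [LinearMap.smul_apply, Module.Basis.coord_apply, smul_eq_mul]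

/-- `tr` is additive. -/
theorem tr_add (y z : GR44) : tr (y + z) = tr y + tr z := by
  unfold tr; exact map_add trL y z

/-- `tr (c • y) = c * tr y`. -/
theorem tr_smul (c : ZMod 4) (y : GR44) : tr (c • y) = c * tr y := by
  unfold tr; rw [map_smul, smul_eq_mul]

/-- `tr (−y) = −tr y`. -/
theorem tr_neg (y : GR44) : tr (-y) = -tr y := by
  unfold tr; exact map_neg trL y

/-- The coordinates of `r ^ k` for `k < 4`: `repr (r ^ k) = single k 1`. -/
theorem repr_r_pow (k : Fin pb.dim) : pb.basis.repr (r ^ (k : ℕ)) = Finsupp.single k 1 := by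
  rw [← pb_basis_apply, Module.Basis.repr_self]

/-- `tr 1 = 0`. -/
theorem tr_one : tr 1 = 0 := by
  have h : (1 : GR44) = r ^ ((idx0 : Fin pb.dim) : ℕ) := by simp [idx0]
  rw [tr_apply, h, repr_r_pow, Finsupp.single_apply, if_neg (by simp [idx0, idx3]), mul_zero]

/-- `tr r = 0`. -/
theorem tr_r : tr r = 0 := by
  have h : r = r ^ ((⟨1, by rw [pb_dim]; norm_num⟩ : Fin pb.dim) : ℕ) := by simp
  rw [tr_apply, h, repr_r_pow, Finsupp.single_apply, if_neg (by simp [idx3]), mul_zero]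

/-- `tr (r²) = 0`. -/
theorem tr_r_sq : tr (r ^ 2) = 0 := by
  have h : r ^ 2 = r ^ ((⟨2, by rw [pb_dim]; norm_num⟩ : Fin pb.dim) : ℕ) := by simp
  rw [tr_apply, h, repr_r_pow, Finsupp.single_apply, if_neg (by simp [idx3]), mul_zero]

/-- `tr (r³) = 3`. -/
theorem tr_r_cube : tr (r ^ 3) = 3 := by
  have h : r ^ 3 = r ^ ((idx3 : Fin pb.dim) : ℕ) := by simp [idx3]
  rw [tr_apply, h, repr_r_pow, Finsupp.single_apply, if_pos rfl, mul_one]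

/-! ### The Frobenius sum is the trace -/

/-- The Frobenius sum `y + φ(y) + φ²(y) + φ³(y)` as a `ℤ/4`-linear map. -/
def frobSumL : GR44 →ₗ[ZMod 4] GR44 :=
  LinearMap.id + frobLift.toLinearMap + (frobLift.comp frobLift).toLinearMap +
    (frobLift.comp (frobLift.comp frobLift)).toLinearMap

/-- `frobSumL y = y + φ y + φ (φ y) + φ (φ (φ y))`. -/
theorem frobSumL_apply (y : GR44) :
    frobSumL y = y + frobLift y + frobLift (frobLift y) + frobLift (frobLift (frobLift y)) := rfl

/-- The trace composed with `algebraMap`, as a linear map `GR(4, 4) → GR(4, 4)`. -/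
def trAlgL : GR44 →ₗ[ZMod 4] GR44 := (Algebra.linearMap (ZMod 4) GR44).comp trL

/-- `φ (r ^ k) = r ^ (2 k)`. -/
theorem frobLift_r_pow (k : ℕ) : frobLift (r ^ k) = r ^ (2 * k) := by
  rw [map_pow, frobLift_r, ← pow_mul]

/-- **`y + φ(y) + φ²(y) + φ³(y) = algebraMap (tr y)`** — checked on the power basis:
`Tr(1) = 4 = 0`, `Tr(r) = r + r² + r⁴ + r⁸ = 0`, `Tr(r²) = r² + r⁴ + r⁸ + r¹⁶ = 0`,
`Tr(r³) = r³ + r⁶ + r¹² + r²⁴ = 3` (each a `linear_combination` of the relation and `4 = 0`). -/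
theorem frobSum_eq_tr (y : GR44) :
    y + frobLift y + frobLift (frobLift y) + frobLift (frobLift (frobLift y)) = algebraMap (ZMod 4) GR44 (tr y) := by
  have h : frobSumL = trAlgL := by
    apply pb.basis.ext
    intro i
    rcases i with ⟨i, hi⟩
    rw [pb_basis_apply, frobSumL_apply, Fin.val_mk, frobLift_r_pow, frobLift_r_pow, frobLift_r_pow]
    change _ = algebraMap (ZMod 4) GR44 (tr (r ^ i))
    have hrel := r_rel
    have h4 := four_eq_zero
    rw [pb_dim] at hi
    interval_cases i
    · rw [pow_zero, tr_one, map_zero]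
      linear_combination h4
    · rw [pow_one, tr_r, map_zero]
      linear_combination (4 - 3 * r - 2 * r ^ 2 + r ^ 4) * hrel + (-1 - 2 * r + r ^ 2 + 3 * r ^ 3) * h4
    · rw [tr_r_sq, map_zero]
      linear_combination (-412 + 108 * r + 181 * r ^ 2 + 33 * r ^ 3 - 48 * r ^ 4 - 30 * r ^ 5 + 5 * r ^ 6
        + 12 * r ^ 7 + 3 * r ^ 8 - 3 * r ^ 9 - 2 * r ^ 10 + r ^ 12) * hrel
        + (103 + 282 * r + 80 * r ^ 2 - 198 * r ^ 3) * h4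
    · rw [tr_r_cube, map_ofNat]
      linear_combination (40541 + 1905 * r - 12937 * r ^ 2 - 5622 * r ^ 3 + 2199 * r ^ 4 + 2742 * r ^ 5
        + 314 * r ^ 6 - 804 * r ^ 7 - 415 * r ^ 8 + 111 * r ^ 9 + 183 * r ^ 10 + 33 * r ^ 11 - 49 * r ^ 12
        - 30 * r ^ 13 + 5 * r ^ 14 + 12 * r ^ 15 + 3 * r ^ 16 - 3 * r ^ 17 - 2 * r ^ 18 + r ^ 20) * hrel
        + (-10136 - 30882 * r - 18465 * r ^ 2 + 10156 * r ^ 3) * h4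
  have := LinearMap.congr_fun h y
  rw [frobSumL_apply] at this
  exact this

/-- `algebraMap : ℤ/4 → GR(4, 4)` is injective (read off the `r⁰`-coordinate). -/
theorem algebraMap_injective : Function.Injective (algebraMap (ZMod 4) GR44) := by
  intro a b hab
  have h : ∀ c : ZMod 4, pb.basis.repr (algebraMap (ZMod 4) GR44 c) idx0 = c := by
    intro c
    have : algebraMap (ZMod 4) GR44 c = c • r ^ ((idx0 : Fin pb.dim) : ℕ) := by
      simp [idx0, Algebra.smul_def]
    rw [this, map_smul, repr_r_pow, Finsupp.smul_apply, Finsupp.single_apply, if_pos rfl, smul_eq_mul, mul_one]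
  rw [← h a, ← h b, hab]

/-- **`tr ∘ σ = tr`**: the Frobenius sum is `φ`-invariant (`φ⁴ = id`), and `σ = φ²`. -/
theorem tr_conjGR (y : GR44) : tr (conjGR y) = tr y := by
  apply algebraMap_injective
  rw [← frobSum_eq_tr, ← frobSum_eq_tr]
  have h2 : ∀ z, conjGR z = frobLift (frobLift z) := fun z => by
    rw [conjGR_eq_frobLift_comp, AlgHom.comp_apply]
  rw [h2]
  simp only [frobLift_four]
  ring

/-! ### The trace-zero unit `δ = 1 + 2r² = r − σ(r)` -/

/-- `δ = 1 + 2r²`. -/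
def delta : GR44 := 1 + 2 * r ^ 2

/-- `δ = r − σ(r) = r − r⁴`. -/
theorem delta_eq : delta = r - r ^ 4 := by
  have h := r_rel
  have h4 := four_eq_zero
  unfold delta
  linear_combination h - r * h4

/-- **`σ(δ) = −δ`**: `δ` has trace zero (it is `r − σ(r)`). -/
theorem conjGR_delta : conjGR delta = -delta := by
  rw [delta_eq, map_sub, conjGR_r, map_pow, conjGR_r]
  have h := r_pow_fifteen
  calc r ^ 4 - (r ^ 4) ^ 4 = r ^ 4 - r ^ 15 * r := by ring
    _ = -(r - r ^ 4) := by rw [h, one_mul]; ring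

/-- **`δ² = 1`**: `δ` is a unit, its own inverse. -/
theorem delta_mul_self : delta * delta = 1 := by
  have h4 := four_eq_zero
  unfold delta
  linear_combination (r ^ 2 + r ^ 4) * h4

/-- `δ` is a unit. -/
theorem isUnit_delta : IsUnit delta := IsUnit.of_mul_eq_one delta delta_mul_self

/-- `0 ≠ 1` in `GR(4, 4)`. -/
theorem zero_ne_one_GR44 : (0 : GR44) ≠ 1 := by
  intro h
  have h' : algebraMap (ZMod 4) GR44 0 = algebraMap (ZMod 4) GR44 1 := by rw [map_zero, map_one]; exact h
  exact absurd (algebraMap_injective h') (by decide)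

/-- `δ ≠ 0`. -/
theorem delta_ne_zero : delta ≠ 0 := by
  intro h
  have := delta_mul_self
  rw [h, mul_zero] at this
  exact zero_ne_one_GR44 this

/-! ### The additive character `ψ̃_δ = ψ₄ ∘ tr ∘ (δ ·)` -/

/-- `i⁴ = 1`. -/
theorem I_pow_four : Complex.I ^ 4 = 1 := by
  rw [show (4 : ℕ) = 2 * 2 from rfl, pow_mul, Complex.I_sq]
  norm_num

/-- The standard character `ψ₄(x) = i^x` of `ℤ/4`. -/
def psi4 : AddChar (ZMod 4) ℂ := AddChar.zmodChar 4 I_pow_four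

/-- `tr (δ ·)` as an additive map. -/
def trDelta : GR44 →+ ZMod 4 where
  toFun y := tr (delta * y)
  map_zero' := by
    show tr (delta * 0) = 0
    rw [mul_zero]; unfold tr; exact map_zero trL
  map_add' y z := by
    show tr (delta * (y + z)) = tr (delta * y) + tr (delta * z)
    rw [mul_add, tr_add]

/-- **The additive character `ψ̃_δ(y) = ψ₄(tr(δ y))`** of `GR(4, 4)`. -/
def psiTildeGR : AddChar GR44 ℂ := psi4.compAddMonoidHom trDelta

/-- `ψ̃_δ(y) = ψ₄(tr(δ y))`. -/
theorem psiTildeGR_apply (y : GR44) : psiTildeGR y = psi4 (tr (delta * y)) := rfl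

/-- **`ψ̃_δ ∘ σ = ψ̃_δ ∘ (−1 ·)`** — the hypothesis `hψ` of gen 3's `conjDual_inert` at conductor `2`:
`δ σ(y) = −σ(δ y)` and `tr ∘ σ = tr`. -/
theorem psiTildeGR_conjGR (y : GR44) : psiTildeGR (conjGR y) = psiTildeGR (-y) := by
  rw [psiTildeGR_apply, psiTildeGR_apply]
  congr 1
  have h : delta * conjGR y = -(conjGR (delta * y)) := by
    rw [map_mul, conjGR_delta]; ring
  rw [h, tr_neg, tr_conjGR, mul_neg, tr_neg]

end GaloisRing

end Summit.Ventures.HodgeRepro.PeriodCloser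

end
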